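import Literature.NumberTheory.Automorphic.LanglandsTunnellBridgeL2
import Literature.NumberTheory.Automorphic.AutomorphicRepsGLCleanModel
import HarnessLib

/-!
# Tunnell's bridge: the `A_G`-normalisation proved outright, assembly from four named facts
(proofs; companion to `Literature.NumberTheory.Automorphic.LanglandsTunnellBridgeL2` and
`…BridgeAssembly`)

`LanglandsTunnellBridgeL2` proves the named fact
`Literature.NumberTheory.Automorphic.hasEntireContinuation_artinLFunction_of_isPiOfArtinRep`
(Tunnell, Bull. AMS 5 (1981), p. 173, ¶2: "When `π = π(ρ)` the L-series of `π` and `ρ` agree, and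
since cuspidal representations have entire L-series, Artin's conjecture follows") from four named
facts of the tree — Artin's functional equation `artin_functional_equation`, Godement–Jacquet for
`GL₂` `godementJacquet (n := 2)`, and Borel–Jacquet's dictionary `AutomorphicRepsGL.exists_isAssociatedL2`,
`hasSatakeParamAt_iff_L2` — plus one unnamed hypothesis (N), the `A_G`-normalisation of cuspidal
Borel–Jacquet data: every cuspidal `π` of `GL₂(𝔸_F)` has, up to a shift `q_v^{-w}`, the Satake
parameters of an `A_G`-invariant cuspidal datum `π₀` ("`π = π₀ ⊗ |det|^{w}` with `π₀` unitary",
Borel–Jacquet 1979, 5.7; Arthur–Clozel 1989, Ch. 3, proof of Thm. 3.1). `LanglandsTunnellBridgeAssembly`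
derived (N) from the named fact `cuspidal_W'_eq_bot` (a stable complement of `W'`), which has since
been **refuted** in the tree (`not_forall_cuspidal_W'_eq_bot`, `AutomorphicRepsGLLogDetCounterexample`:
the datum `span {log |det|_𝔸, 1} / ℂ·1` on `GL_1`), so that the five-fact assembly
`hasEntireContinuation_artinLFunction_of_isPiOfArtinRep_of_facts` can only ever be applied vacuously.

This file **proves (N) outright** for `GL_n`, `n ≥ 1` — no semisimplicity, no complement, no named
fact — and reassembles the bridge from the four true named facts:

* `CuspidalAutomorphicRepData.exists_eigenModel_hasSatakeParamAt` — **the eigen-model**: every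
  cuspidal datum `π = W / W'` of `GL_n(𝔸_K)` (`n ≥ 0`) has a cuspidal model `π₁ = W₁ / W₁'` on whose
  whole space `W₁` the split centre `A_G` acts by a character `a ↦ a^μ`, every Satake parameter of
  which (at any finite place, modulo `W₁'`) is a Satake parameter of `π`. Construction (Borel–Jacquet
  1979, 5.7, made unconditional; the generalised-eigenspace device of `AutomorphicRepsGLCleanModel`,
  steps (B), (C), (E) there, with the semisimplicity step (D) replaced by a lattice isomorphism): let
  `1 ∈ 𝔤` be the central element generating `A_G`, `S_μ = 1 - μ`; some `φ ∈ W ∖ W'` is killed by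
  some `S_μ^k` (`exists_mem_iterate_shiftLie_eq_zero`); with `k₀ ≥ 1` least such that
  `M_{k₀} = W ∩ ker S_μ^{k₀} ⊄ W'` and `N = S_μ^{k₀-1}`, put `W₁ = N(M_{k₀}) ⊋ W₁' = N(M_{k₀} ∩ W')`.
  Since `ker N ∩ M_{k₀} = M_{k₀-1} ⊆ W'` and `M_{k₀} + W' = W` (irreducibility of `W / W'`), `N`
  induces a lattice isomorphism between the stable subspaces of `M_{k₀}` containing `M_{k₀} ∩ W'` and
  those of `W₁` containing `W₁'`, and `U ↦ U + W'` embeds the former into the two-element interval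
  `[W', W]`; hence `W₁ / W₁'` is irreducible. On `W₁ ⊆ ker S_μ`, `1 = μ`, so `A_G` acts by `a ↦ a^μ`
  (`apply_posRealScalar_mul_of_lieDeriv_one_eq_smul`). Satake parameters transfer by averaging a
  preimage over `K(𝔫) / (K(𝔫) ∩ U₀)` exactly as in step (E) of the clean model, the Hecke
  congruences now holding modulo `W₁'` and being pulled back through `N⁻¹(W₁') ∩ M_{k₀} ⊆ W'`.
* `CuspidalAutomorphicRepData.exists_centerInvariant_hasSatakeParamAt_shift` — **(N) with no
  hypothesis** (`n ≥ 1`): twist the eigen-model by `|det|_𝔸^{s}`, `s n [K:ℚ] = -μ`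
  (`AutomorphicTwistNorm`), exactly as in `LanglandsTunnellBridgeAssembly`.
* `hasEntireContinuation_artinLFunction_of_isPiOfArtinRep_of_four_facts` — **the bridge from four
  named facts and nothing else**: (FE) `artin_functional_equation`, (GJ) `godementJacquet (n := 2)`,
  `AutomorphicRepsGL.exists_isAssociatedL2`, `hasSatakeParamAt_iff_L2` (all for `GL₂` over every
  number field, level and automorphic measure);
* `langlands_tunnell_hasEntireContinuation_of_cases_of_four_facts` — the target over `ℚ` from the
  three cases of strong Artin and the same four facts.

Consequently the discharge `hasEntireContinuation_artinLFunction_of_isPiOfArtinRep_holds` is the term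
`hasEntireContinuation_artinLFunction_of_isPiOfArtinRep_of_four_facts` applied to the four `_holds`
theorems of those facts, once they exist. Everything here is proved; no definition, no named fact.

## References

* J. Tunnell, *Artin's conjecture for representations of octahedral type*, Bull. AMS 5 (1981),
  p. 173 [Tunnell1981].
* A. Borel, H. Jacquet, *Automorphic forms and automorphic representations*, Proc. Sympos. Pure
  Math. 33 (1979), part 1, §4.6, 5.7 [BorelJacquetCorvallis1979].
* J. Arthur, L. Clozel, *Simple algebras, base change, and the advanced theory of the trace
  formula*, Ann. of Math. Stud. 120 (1989), Ch. 3, proof of Thm. 3.1 [ArthurClozelAMS120].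
* R. Godement, H. Jacquet, *Zeta functions of simple algebras*, LNM 260 (1972), Thm. 13.8
  [GodementJacquet1972].
-/

-- Mathlib idiom (Mathlib/Algebra/Lie/OfAssociative.lean); needed to mention Lie subalgebras of matrix algebras
attribute [local instance 100] LieRing.ofAssociativeRing

noncomputable section

open scoped MatrixGroups NNReal Classical
open NumberField NumberField.mixedEmbedding IsDedekindDomain MeasureTheory Filter

namespace Literature.NumberTheory.Automorphic

open Literature.NumberTheory.GaloisRepresentations (HeckeCharacter ideleGroup)

/-! ### The eigen-model of a cuspidal datum -/

section EigenModel

variable {n : ℕ} {K : Type} [Field K] [NumberField K] {hcpt : isCompact_glFiniteIntegralLevel n K}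

set_option quotPrecheck false in
/-- `S_μ ψ = 1·ψ - μ ψ`, the shifted Lie derivative along the central element `1 ∈ 𝔤𝔩_n(K_∞)`
(local notation, verbatim that of `AutomorphicRepsGLCleanModel`). -/
local notation "S[" hc ", " μ "]" =>
  (fun ψ : (AdelicGroupData.gl n K).Adelic → ℂ =>
    lieDeriv (AutomorphyDatum.gl n K hc).ofArch (⟨1, trivial⟩ : (AutomorphyDatum.gl n K hc).arch.lie) ψ - μ • ψ)

set_option maxHeartbeats 400000 in
/-- **The eigen-model of a cuspidal automorphic representation of `GL_n(𝔸_K)`** (Borel–Jacquet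
datum, arbitrary behaviour on the split centre `A_G`). For every cuspidal `π = W / W'` there are a
cuspidal datum `π₁ = W₁ / W₁'` (`W₁ ≤ W`) and `μ ∈ ℂ` such that `A_G` acts on **all** of `W₁` by the
character `a ↦ a^μ` — `ψ (a g) = a^μ ψ (g)` for `ψ ∈ W₁`, `a ∈ A_G` — and every Satake parameter of
`π₁` at a finite place `v` is a Satake parameter of `π` at `v` (same level, same uniformizer).
With `1 ∈ 𝔤` the central element generating `A_G` and `S_μ = 1 - μ`: some `φ ∈ W ∖ W'` is killed by
some `S_μ^k` (`AutomorphicRepData.exists_mem_iterate_shiftLie_eq_zero`); for `k₀ ≥ 1` least with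
`M_{k₀} = W ∩ ker S_μ^{k₀} ⊄ W'` and `N = S_μ^{k₀-1}` take `W₁ = N(M_{k₀})`, `W₁' = N(M_{k₀} ∩ W')`.
Irreducibility of `W₁ / W₁'`: a stable `U` with `W₁' ≤ U ≤ W₁` pulls back to the stable
`Ũ = M_{k₀} ∩ N⁻¹(U) ⊇ M_{k₀} ∩ W'`, and `Ũ + W'` is `W'` or `W`; in the first case
`U = N(Ũ) ⊆ N(M_{k₀} ∩ W') = W₁'`, in the second `M_{k₀} ⊆ Ũ + W'` forces `Ũ = M_{k₀}` (as
`M_{k₀} ∩ W' ⊆ Ũ`), so `U = W₁`. The character: `1 = μ` on `W₁ ⊆ ker S_μ`, and the ODE along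
`exp (t·1)` (`apply_posRealScalar_mul_of_lieDeriv_one_eq_smul`). Satake parameters: if
`f = N x ∈ W₁ ∖ W₁'` is `K(𝔫)`-invariant with `T_{v,i} f - c_i f ∈ W₁'`, average `x ∈ M_{k₀}` over
`K(𝔫) / (K(𝔫) ∩ U₀)` to a `K(𝔫)`-invariant `x̄ ∈ M_{k₀} ∖ W'` with `N x̄ = [K(𝔫) : K(𝔫) ∩ U₀] f`;
then `N (T_{v,i} x̄ - c_i x̄) ∈ W₁'` and `M_{k₀} ∩ N⁻¹(W₁') ⊆ (M_{k₀} ∩ W') + M_{k₀-1} ⊆ W'`.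
This is the unconditional content of "`π = π₀ ⊗ χ` with `π₀` having a central character on `A_G`"
(Borel–Jacquet 1979, 5.7), cf. the clean model `exists_clean_hasSatakeParamAt_of_sSup_irreducible`,
which needs semisimplicity to make `W₁' = ⊥`. [cite: BorelJacquetCorvallis1979, §4.6 and 5.7] -/
theorem CuspidalAutomorphicRepData.exists_eigenModel_hasSatakeParamAt
    (π : CuspidalAutomorphicRepData n K hcpt) :
    ∃ (π₁ : CuspidalAutomorphicRepData n K hcpt) (μ : ℂ), π₁.1.W ≤ π.1.W ∧
      (∀ ψ ∈ π₁.1.W, ∀ (t : ℝ≥0ˣ) (g : (AdelicGroupData.gl n K).Adelic),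
        ψ ((show (AdelicGroupData.gl n K).Adelic from posRealScalar n K t) * g) =
          (((t : ℝ≥0) : ℝ) : ℂ) ^ μ * ψ g) ∧
      ∀ (v : HeightOneSpectrum (𝓞 K)) (β : Multiset ℂ),
        π₁.1.HasSatakeParamAt v β → π.1.HasSatakeParamAt v β := by
  classical
  -- (B) an eigencomponent outside `W'`
  obtain ⟨μ, k₁, φ₁, hφ₁W, hφ₁W', hφ₁k⟩ := π.1.exists_mem_iterate_shiftLie_eq_zero
  -- (C) the generalised kernels `M k = W ∩ ker S_μ^k`
  let M : ℕ → Submodule ℂ ((AdelicGroupData.gl n K).Adelic → ℂ) := fun k =>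
    { carrier := {φ | φ ∈ π.1.W ∧ (S[hcpt, μ])^[k] φ = 0}
      add_mem' := fun {a b} ha hb => ⟨add_mem ha.1 hb.1, by
        rw [iterate_shiftLie_add π.1.stable μ k ha.1 hb.1, ha.2, hb.2, add_zero]⟩
      zero_mem' := ⟨zero_mem _, iterate_shiftLie_zero μ k⟩
      smul_mem' := fun c a ha => ⟨Submodule.smul_mem _ c ha.1, by
        rw [iterate_shiftLie_smul, ha.2, smul_zero]⟩ }
  have hMmem : ∀ k φ, φ ∈ M k ↔ φ ∈ π.1.W ∧ (S[hcpt, μ])^[k] φ = 0 := fun k φ => Iff.rfl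
  have hex : ∃ k, ¬ (M k ≤ π.1.W') := ⟨k₁, fun h => hφ₁W' (h ((hMmem _ _).2 ⟨hφ₁W, hφ₁k⟩))⟩
  set k₀ := Nat.find hex with hk₀def
  have hk₀ : ¬ (M k₀ ≤ π.1.W') := Nat.find_spec hex
  have hmin : ∀ k < k₀, M k ≤ π.1.W' := fun k hk => not_not.1 (Nat.find_min hex hk)
  have hk₀pos : 0 < k₀ := by
    rw [Nat.pos_iff_ne_zero]
    intro h0
    refine hk₀ fun φ hφ => ?_
    have h2 := ((hMmem _ _).1 hφ).2
    rw [h0, Function.iterate_zero_apply] at h2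
    rw [h2]
    exact zero_mem _
  set j := k₀ - 1 with hj
  have hjk : j + 1 = k₀ := Nat.succ_pred_eq_of_pos hk₀pos
  have hker : M j ≤ π.1.W' := hmin j (by omega)
  have hMst : IsStableSubmodule (AutomorphyDatum.gl n K hcpt) (M k₀) :=
    isStableSubmodule_of_mem_iff_iterate_eq_zero π.1.stable μ k₀ (hMmem k₀)
  have hMW : M k₀ ≤ π.1.W := fun φ hφ => ((hMmem _ _).1 hφ).1
  -- the images `NM = N(M k₀)`, `NM' = N(M k₀ ∩ W')`, `N = S_μ^j`
  let NM : Submodule ℂ ((AdelicGroupData.gl n K).Adelic → ℂ) :=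
    { carrier := {ψ | ∃ φ ∈ M k₀, (S[hcpt, μ])^[j] φ = ψ}
      add_mem' := by
        rintro _ _ ⟨a, ha, rfl⟩ ⟨b, hb, rfl⟩
        exact ⟨a + b, add_mem ha hb, iterate_shiftLie_add π.1.stable μ j (hMW ha) (hMW hb)⟩
      zero_mem' := ⟨0, zero_mem _, iterate_shiftLie_zero μ j⟩
      smul_mem' := by
        rintro c _ ⟨a, ha, rfl⟩
        exact ⟨c • a, Submodule.smul_mem _ c ha, iterate_shiftLie_smul μ j c a⟩ }
  have hNMmem : ∀ ψ, ψ ∈ NM ↔ ∃ φ ∈ M k₀, (S[hcpt, μ])^[j] φ = ψ := fun ψ => Iff.rfl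
  let NM' : Submodule ℂ ((AdelicGroupData.gl n K).Adelic → ℂ) :=
    { carrier := {ψ | ∃ φ ∈ M k₀ ⊓ π.1.W', (S[hcpt, μ])^[j] φ = ψ}
      add_mem' := by
        rintro _ _ ⟨a, ha, rfl⟩ ⟨b, hb, rfl⟩
        exact ⟨a + b, add_mem ha hb, iterate_shiftLie_add π.1.stable μ j (hMW ha.1) (hMW hb.1)⟩
      zero_mem' := ⟨0, zero_mem _, iterate_shiftLie_zero μ j⟩
      smul_mem' := by
        rintro c _ ⟨a, ha, rfl⟩
        exact ⟨c • a, Submodule.smul_mem _ c ha, iterate_shiftLie_smul μ j c a⟩ }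
  have hNM'mem : ∀ ψ, ψ ∈ NM' ↔ ∃ φ ∈ M k₀ ⊓ π.1.W', (S[hcpt, μ])^[j] φ = ψ := fun ψ => Iff.rfl
  have hNM'le : NM' ≤ NM := by
    rintro _ ⟨a, ha, rfl⟩
    exact ⟨a, ha.1, rfl⟩
  have hMW'st : IsStableSubmodule (AutomorphyDatum.gl n K hcpt) (M k₀ ⊓ π.1.W') := hMst.inf π.1.stable'
  have hNMst : IsStableSubmodule (AutomorphyDatum.gl n K hcpt) NM :=
    isStableSubmodule_of_mem_iff_exists_iterate_eq hMst μ j hNMmem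
  have hNM'st : IsStableSubmodule (AutomorphyDatum.gl n K hcpt) NM' :=
    isStableSubmodule_of_mem_iff_exists_iterate_eq hMW'st μ j hNM'mem
  have hNM_W : NM ≤ π.1.W := by
    rintro _ ⟨a, ha, rfl⟩
    exact iterate_shiftLie_mem π.1.stable μ j (hMW ha)
  -- `N φ ∈ NM'` forces `φ ∈ W'` (for `φ ∈ M k₀`): the kernel of `N` on `M k₀` is `M j ≤ W'`
  have key_out : ∀ φ ∈ M k₀, (S[hcpt, μ])^[j] φ ∈ NM' → φ ∈ π.1.W' := by
    rintro φ hφ ⟨a, ha, hEq⟩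
    have h0 : (S[hcpt, μ])^[j] (φ - a) = 0 := by
      rw [iterate_shiftLie_sub π.1.stable μ j (hMW hφ) (hMW ha.1), hEq, sub_self]
    have hsub : φ - a ∈ π.1.W' := hker ((hMmem _ _).2 ⟨sub_mem (hMW hφ) (hMW ha.1), h0⟩)
    have : φ = (φ - a) + a := by abel
    rw [this]
    exact add_mem hsub ha.2
  obtain ⟨x₀, hx₀M, hx₀W'⟩ := SetLike.not_le_iff_exists.1 hk₀
  have hlt : NM' < NM := by
    refine lt_of_le_of_ne hNM'le fun h => hx₀W' (key_out x₀ hx₀M ?_)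
    rw [h]
    exact ⟨x₀, hx₀M, rfl⟩
  -- `1` acts by `μ` on `NM`, so `A_G` acts by `a ↦ a^μ`
  have hTNM : ∀ ψ ∈ NM, lieDeriv (AutomorphyDatum.gl n K hcpt).ofArch
      (⟨1, trivial⟩ : (AutomorphyDatum.gl n K hcpt).arch.lie) ψ = μ • ψ := by
    rintro _ ⟨a, ha, rfl⟩
    have h := ((hMmem _ _).1 ha).2
    rw [← hjk, Function.iterate_succ_apply'] at h
    exact sub_eq_zero.1 h
  have hAG : ∀ ψ ∈ NM, ∀ (t : ℝ≥0ˣ) (g : (AdelicGroupData.gl n K).Adelic),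
      ψ ((show (AdelicGroupData.gl n K).Adelic from posRealScalar n K t) * g) =
        (((t : ℝ≥0) : ℝ) : ℂ) ^ μ * ψ g := fun ψ hψ t g =>
    apply_posRealScalar_mul_of_lieDeriv_one_eq_smul (π.1.stable.isArchSmooth (hNM_W hψ)) (hTNM ψ hψ) t g
  -- (D') irreducibility of `NM / NM'` through the lattice isomorphism induced by `N`
  have hirr : ∀ U : Submodule ℂ ((AdelicGroupData.gl n K).Adelic → ℂ), NM' ≤ U → U ≤ NM →
      IsStableSubmodule (AutomorphyDatum.gl n K hcpt) U → U = NM' ∨ U = NM := by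
    intro U hU₁ hU₂ hUst
    -- the pull-back `Ut = M k₀ ∩ N⁻¹(U)`
    let Ut : Submodule ℂ ((AdelicGroupData.gl n K).Adelic → ℂ) :=
      { carrier := {φ | φ ∈ M k₀ ∧ (S[hcpt, μ])^[j] φ ∈ U}
        add_mem' := fun {a b} ha hb => ⟨add_mem ha.1 hb.1, by
          rw [iterate_shiftLie_add π.1.stable μ j (hMW ha.1) (hMW hb.1)]
          exact add_mem ha.2 hb.2⟩
        zero_mem' := ⟨zero_mem _, by rw [iterate_shiftLie_zero μ j]; exact zero_mem _⟩
        smul_mem' := fun c a ha => ⟨Submodule.smul_mem _ c ha.1, by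
          rw [iterate_shiftLie_smul]
          exact Submodule.smul_mem _ c ha.2⟩ }
    have hUtmem : ∀ φ, φ ∈ Ut ↔ φ ∈ M k₀ ∧ (S[hcpt, μ])^[j] φ ∈ U := fun φ => Iff.rfl
    have hUtM : Ut ≤ M k₀ := fun φ hφ => ((hUtmem φ).1 hφ).1
    have hUtst : IsStableSubmodule (AutomorphyDatum.gl n K hcpt) Ut :=
      { le_automorphicForms := fun φ hφ => π.1.stable.le_automorphicForms (hMW (hUtM hφ))
        finite_stable := fun h hh φ hφ => by
          rw [Submodule.mem_comap, hUtmem]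
          refine ⟨hMst.finite_stable h hh ((hUtmem φ).1 hφ).1, ?_⟩
          rw [iterate_shiftLie_rightTranslation]
          exact hUst.finite_stable h hh ((hUtmem φ).1 hφ).2
        k_stable := fun kk φ hφ => by
          rw [Submodule.mem_comap, hUtmem]
          refine ⟨hMst.k_stable kk ((hUtmem φ).1 hφ).1, ?_⟩
          rw [iterate_shiftLie_rightTranslation]
          exact hUst.k_stable kk ((hUtmem φ).1 hφ).2
        lie_stable := fun X φ hφ => by
          rw [hUtmem]
          refine ⟨hMst.lie_stable X φ ((hUtmem φ).1 hφ).1, ?_⟩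
          rw [iterate_shiftLie_lieDeriv π.1.stable μ j X (hMW ((hUtmem φ).1 hφ).1)]
          exact hUst.lie_stable X _ ((hUtmem φ).1 hφ).2 }
    have hW'Ut : M k₀ ⊓ π.1.W' ≤ Ut := fun φ hφ => (hUtmem φ).2 ⟨hφ.1, hU₁ ⟨φ, hφ, rfl⟩⟩
    rcases π.1.irreducible (Ut ⊔ π.1.W') le_sup_right (sup_le (hUtM.trans hMW) π.1.lt.le)
        (hUtst.sup π.1.stable') with h | h
    · -- `Ut ≤ W'`: then `U = N(Ut) ≤ N(M k₀ ∩ W') = NM'`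
      left
      refine le_antisymm (fun u hu => ?_) hU₁
      obtain ⟨φ, hφM, rfl⟩ := (hNMmem _).1 (hU₂ hu)
      have hφUt : φ ∈ Ut := (hUtmem φ).2 ⟨hφM, hu⟩
      have hφW' : φ ∈ π.1.W' := by
        have hφ' : φ ∈ Ut ⊔ π.1.W' := Submodule.mem_sup_left hφUt
        rwa [h] at hφ'
      exact ⟨φ, ⟨hφM, hφW'⟩, rfl⟩
    · -- `Ut + W' = W`: then `M k₀ ≤ Ut`, so `NM ≤ U`
      right
      refine le_antisymm hU₂ ?_
      rintro _ ⟨φ, hφM, rfl⟩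
      have hφmem : φ ∈ Ut ⊔ π.1.W' := by
        rw [h]
        exact hMW hφM
      obtain ⟨u, hu, w, hw, huw⟩ := Submodule.mem_sup.1 hφmem
      have hwM : w ∈ M k₀ := by
        have hw' : w = φ - u := by rw [← huw]; abel
        rw [hw']
        exact sub_mem hφM (hUtM hu)
      have hφUt : φ ∈ Ut := by
        rw [← huw]
        exact add_mem hu (hW'Ut ⟨hwM, hw⟩)
      exact ((hUtmem φ).1 hφUt).2
  -- the eigen-model `π₁ = NM / NM'`
  let π₁ : CuspidalAutomorphicRepData n K hcpt :=
    ⟨{ W := NM, W' := NM', lt := hlt, stable := hNMst, stable' := hNM'st, irreducible := hirr },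
      hNM_W.trans π.2⟩
  refine ⟨π₁, μ, hNM_W, fun ψ hψ t g => hAG ψ hψ t g, fun v β hβ => ?_⟩
  -- (E) Satake parameters of `NM / NM'` are Satake parameters of `π`
  obtain ⟨𝔫, ϖ, h𝔫, hv𝔫, hϖ, hcard, f, hfC, hf0, hfix, hHecke⟩ := hβ
  change f ∈ NM at hfC
  change f ∉ NM' at hf0
  obtain ⟨x, hxM, hxf⟩ := (hNMmem f).1 hfC
  -- a level: `x` is fixed by an open `U₀ ≤ GL_n(𝔸_K^∞)`
  obtain ⟨U₀, hU₀, hU₀x⟩ :=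
    exists_isOpen_forall_rightTranslation_ofFinite_eq (π.1.stable.le_automorphicForms (hMW hxM))
  -- average over `K(𝔫) / (K(𝔫) ∩ U₀)`
  set Kn : Subgroup (AdelicGroupData.gl n K).Adelic := principalCongruenceLevel n K 𝔫 with hKn
  set N₀ : Subgroup Kn := (U₀.comap (GLn.sndHom n K)).subgroupOf Kn with hN₀
  haveI : N₀.FiniteIndex := finiteIndex_subgroupOf_principalCongruenceLevel h𝔫 hU₀
  set ρ : Representation ℂ (AdelicGroupData.gl n K).Adelic ((AdelicGroupData.gl n K).Adelic → ℂ) :=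
    rightTranslation (AdelicGroupData.gl n K) with hρ
  have hKn_le : ∀ k ∈ Kn, k ∈ glIntegralLevel n K := fun k hk => principalCongruenceLevel_le n K 𝔫 hk
  have hKn_fin : ∀ k ∈ Kn, k ∈ (AutomorphyDatum.gl n K hcpt).finiteAdelic := fun k hk =>
    ⟨GLn.sndHom n K k, GLn.ofFinite_sndHom_of_mem (hKn_le k hk)⟩
  set xbar := (∑ᶠ q : Kn ⧸ N₀, ρ ((q.out : Kn) : (AdelicGroupData.gl n K).Adelic)) x with hxbar
  have hxN₀ : ∀ m : Kn, m ∈ N₀ → ρ (m : (AdelicGroupData.gl n K).Adelic) x = x := by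
    intro m hm
    have hm' : GLn.sndHom n K (m : (AdelicGroupData.gl n K).Adelic) ∈ U₀ :=
      Subgroup.mem_comap.1 (Subgroup.mem_subgroupOf.1 hm)
    have := hU₀x _ hm'
    rwa [GLn.ofFinite_sndHom_of_mem (hKn_le _ m.2)] at this
  have hxbar_fix : xbar ∈ ρ.fixedPoints Kn := subgroupQuotientSum_apply_mem_fixedPoints ρ Kn N₀ hxN₀
  have hxbarM : xbar ∈ M k₀ :=
    subgroupQuotientSum_apply_mem ρ Kn N₀ (fun g hg w hw => hMst.finite_stable g (hKn_fin g hg) hw) hxM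
  have hfK : f ∈ ρ.fixedPoints Kn :=
    (isRightInvariantUnder_iff_mem_fixedPoints _ _ _).mp fun u hu y => congrFun (hfix u hu) y
  have hNxbar : (S[hcpt, μ])^[j] xbar = (Nat.card (Kn ⧸ N₀) : ℂ) • f := by
    rw [hxbar, iterate_shiftLie_subgroupQuotientSum π.1.stable μ j hKn_fin N₀ (hMW hxM), hxf]
    exact subgroupQuotientSum_apply_of_mem_fixedPoints ρ Kn N₀ hfK
  have hcard0 : (Nat.card (Kn ⧸ N₀) : ℂ) ≠ 0 := Nat.cast_ne_zero.2 Nat.card_pos.ne'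
  have hxbarW' : xbar ∉ π.1.W' := by
    intro h
    have h1 : (S[hcpt, μ])^[j] xbar ∈ NM' := ⟨xbar, ⟨hxbarM, h⟩, rfl⟩
    refine hf0 ?_
    have h2 := NM'.smul_mem ((Nat.card (Kn ⧸ N₀) : ℂ)⁻¹) h1
    rwa [hNxbar, inv_smul_smul₀ hcard0] at h2
  refine ⟨𝔫, ϖ, h𝔫, hv𝔫, hϖ, hcard, xbar, hMW hxbarM, hxbarW', fun u hu => ?_, fun i hi => ?_⟩
  · exact (ρ.mem_fixedPoints Kn xbar).1 hxbar_fix u hu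
  · -- Hecke congruences modulo `W'`, pulled back from congruences modulo `NM'`
    have ht : (heckeDiagAt n K v ϖ i : (AdelicGroupData.gl n K).Adelic) ∈
        (AutomorphyDatum.gl n K hcpt).finiteAdelic := by
      rw [heckeDiagAt_eq_ofLocal_glDiagonal]
      exact GLn.ofLocal_mem_range_ofFinite v _
    have hfin := finite_orbit_heckeDiagAt (n := n) h𝔫 hv𝔫 hϖ i
    have hTmem : heckeOperator ρ Kn (heckeDiagAt n K v ϖ i) xbar ∈ M k₀ :=
      heckeOperator_apply_mem_of_isStableSubmodule hMst hKn_fin ht hfin hxbarM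
    have hyM : heckeOperator ρ Kn (heckeDiagAt n K v ϖ i) xbar -
        ((((Real.sqrt (v.residueCard : ℝ)) : ℝ) : ℂ) ^ (i * (n - i)) * β.esymm i) • xbar ∈ M k₀ :=
      sub_mem hTmem (Submodule.smul_mem _ _ hxbarM)
    have hH : heckeOperator ρ Kn (heckeDiagAt n K v ϖ i) f -
        ((((Real.sqrt (v.residueCard : ℝ)) : ℝ) : ℂ) ^ (i * (n - i)) * β.esymm i) • f ∈ NM' := by
      have hH' := hHecke i hi
      change _ ∈ NM' at hH'
      exact hH'
    have hN : (S[hcpt, μ])^[j] (heckeOperator ρ Kn (heckeDiagAt n K v ϖ i) xbar -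
        ((((Real.sqrt (v.residueCard : ℝ)) : ℝ) : ℂ) ^ (i * (n - i)) * β.esymm i) • xbar) =
        (Nat.card (Kn ⧸ N₀) : ℂ) • (heckeOperator ρ Kn (heckeDiagAt n K v ϖ i) f -
          ((((Real.sqrt (v.residueCard : ℝ)) : ℝ) : ℂ) ^ (i * (n - i)) * β.esymm i) • f) := by
      rw [iterate_shiftLie_sub π.1.stable μ j (hMW hTmem) (Submodule.smul_mem _ _ (hMW hxbarM)),
        iterate_shiftLie_smul, iterate_shiftLie_heckeOperator π.1.stable μ j hKn_fin ht hfin (hMW hxbarM),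
        hNxbar, map_smul, smul_comm _ ((Nat.card (Kn ⧸ N₀) : ℂ)), ← smul_sub]
    refine key_out _ hyM ?_
    rw [hN]
    exact NM'.smul_mem _ hH

end EigenModel

/-! ### (N): the `A_G`-normalisation of a cuspidal Borel–Jacquet datum, unconditionally -/

section Normalisation

variable {n : ℕ} {K : Type} [Field K] [NumberField K] {hcpt : isCompact_glFiniteIntegralLevel n K}

/-- **"We may assume `π` unitary" at the level of Satake parameters, unconditionally**
(Borel–Jacquet 1979, 5.7: "`π = π₀ ⊗ |det|^s` with `π₀` unitary"; Arthur–Clozel 1989, Ch. 3, proof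
of Thm. 3.1): for every cuspidal datum `π` of `GL_n(𝔸_K)`, `n ≥ 1`, there are an `A_G`-invariant
cuspidal datum `π₀` and `w ∈ ℂ` such that whenever `β` is a Satake parameter of `π₀` at a finite
place `v`, the multiset `β · q_v^{-w}` is a Satake parameter of `π` at `v`. Proof: take the
eigen-model `π₁` of `π` (`exists_eigenModel_hasSatakeParamAt`: `A_G` acts on `W₁` by `a ↦ a^μ`, and
the Satake parameters of `π₁` are Satake parameters of `π`); `π₀ := π₁ ⊗ |det|_𝔸^{s}`,
`s = -μ/(n[K:ℚ])`, is cuspidal and `A_G`-invariant (`exists_cuspidalAutomorphicRepData_map_mulChar_detTwist`,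
`mulChar_detTwist_apply_posRealScalar_mul_of_cpow`); untwisting by `|det|^{-s}` multiplies Satake
parameters by `q_v^{s}` (`AutomorphicRepData.HasSatakeParamAt.of_map_mulChar_detTwist_of_cpow`); take
`w := -s`. This replaces `CuspidalAutomorphicRepData.exists_centerInvariant_satake_shift` of
`LanglandsTunnellBridgeAssembly`, whose hypothesis `cuspidal_W'_eq_bot` is refuted in the tree.
[cite: BorelJacquetCorvallis1979, 5.7] [cite: ArthurClozelAMS120, Ch. 3, proof of Thm. 3.1] -/
theorem CuspidalAutomorphicRepData.exists_centerInvariant_hasSatakeParamAt_shift [NeZero n]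
    (π : CuspidalAutomorphicRepData n K hcpt) :
    ∃ (π₀ : CuspidalAutomorphicRepData n K hcpt) (w : ℂ),
      (∀ φ ∈ π₀.1.W, ∀ z ∈ (AdelicGroupData.gl n K).center', ∀ g, φ (z * g) = φ g) ∧
      ∀ (v : HeightOneSpectrum (𝓞 K)) (β : Multiset ℂ), π₀.1.HasSatakeParamAt v β →
        π.1.HasSatakeParamAt v (β.map (· * (v.residueCard : ℂ) ^ (-w))) := by
  -- the eigen-model `π₁` and its `A_G`-character `a ↦ a^μ`
  obtain ⟨π₁, μ, -, hμ, htr⟩ := π.exists_eigenModel_hasSatakeParamAt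
  -- the normalising exponent `s₀ = -μ / (n [K:ℚ])` and the character `|·|_𝔸^{s₀}`
  have hnd : ((n * Module.finrank ℚ K : ℕ) : ℂ) ≠ 0 := by
    exact_mod_cast (Nat.mul_ne_zero (NeZero.ne n) Module.finrank_pos.ne')
  set s₀ : ℂ := -μ / (n * Module.finrank ℚ K : ℕ) with hs₀
  have hs : s₀ * (n * Module.finrank ℚ K : ℕ) = -μ := by rw [hs₀, div_mul_cancel₀ _ hnd]
  obtain ⟨χ, hχ⟩ := exists_heckeCharacter_ideleNorm_cpow K s₀
  -- the twisted datum `π₀ = π₁ ⊗ |det|^{s₀}`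
  obtain ⟨π₀, h0W, h0W'⟩ := exists_cuspidalAutomorphicRepData_map_mulChar_detTwist hχ π₁
  refine ⟨π₀, -s₀, fun φ hφ z hz g => ?_, fun v β hβ => ?_⟩
  · -- `A_G`-invariance of the twisted forms
    rw [h0W] at hφ
    obtain ⟨φ₁, hφ₁, rfl⟩ := hφ
    obtain ⟨t, rfl⟩ := hz
    exact mulChar_detTwist_apply_posRealScalar_mul_of_cpow hχ hs (hμ φ₁ hφ₁) t g
  · -- untwist: `π₁ = π₀ ⊗ |det|^{-s₀}` has the Satake parameter `q_v^{s₀} β`, and so does `π`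
    have h1W : π₁.1.W = π₀.1.W.map (mulChar (detTwist n χ⁻¹)) := by
      rw [h0W, detTwist_inv, map_mulChar_inv_map_mulChar]
    have h1W' : π₁.1.W' = π₀.1.W'.map (mulChar (detTwist n χ⁻¹)) := by
      rw [h0W', detTwist_inv, map_mulChar_inv_map_mulChar]
    have h1 : π₁.1.HasSatakeParamAt v (β.map (((v.residueCard : ℂ) ^ (-(-s₀))) * ·)) :=
      AutomorphicRepData.HasSatakeParamAt.of_map_mulChar_detTwist_of_cpow (inv_apply_of_cpow hχ)
        h1W h1W' hβ
    have hπ : π.1.HasSatakeParamAt v (β.map (((v.residueCard : ℂ) ^ (-(-s₀))) * ·)) := htr v _ h1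
    have hcomm : β.map (· * (v.residueCard : ℂ) ^ (-(-s₀))) =
        β.map (((v.residueCard : ℂ) ^ (-(-s₀))) * ·) :=
      Multiset.map_congr rfl fun x _ => mul_comm _ _
    rw [hcomm]
    exact hπ

/-- (N) in the almost-everywhere form consumed by
`hasEntireContinuation_artinLFunction_of_isPiOfArtinRep_of_godementJacquet_of_isAssociatedL2`.
[cite: BorelJacquetCorvallis1979, 5.7] -/
theorem CuspidalAutomorphicRepData.exists_centerInvariant_hasSatakeParamAt_shift_eventually [NeZero n]
    (π : CuspidalAutomorphicRepData n K hcpt) :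
    ∃ (π₀ : CuspidalAutomorphicRepData n K hcpt) (w : ℂ),
      (∀ φ ∈ π₀.1.W, ∀ z ∈ (AdelicGroupData.gl n K).center', ∀ g, φ (z * g) = φ g) ∧
      ∀ᶠ v in cofinite, ∀ β : Multiset ℂ, π₀.1.HasSatakeParamAt v β →
        π.1.HasSatakeParamAt v (β.map (· * (v.residueCard : ℂ) ^ (-w))) := by
  obtain ⟨π₀, w, h₀, h⟩ := π.exists_centerInvariant_hasSatakeParamAt_shift
  exact ⟨π₀, w, h₀, Eventually.of_forall h⟩

end Normalisation

/-! ### The bridge from four named facts -/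

section Main

/-- **Tunnell's bridge from four named facts of the tree.** Assume, for `GL₂` over every number
field (every compact-level witness, every automorphic measure): (FE) `artin_functional_equation`
(Neukirch VII (12.6)); (GJ) `godementJacquet (n := 2)` (the standard L-function of a cuspidal
`Π ≤ L²_cusp` is entire with functional equation against the contragredient; Godement–Jacquet 1972,
Thm. 13.8; for `n = 2` Jacquet–Langlands 1970, Thm. 11.1); and Borel–Jacquet's dictionary between
cuspidal data and `L²_cusp` — `AutomorphicRepsGL.exists_isAssociatedL2` (an `A_G`-invariant cuspidal
datum is associated with a cuspidal subrepresentation of `L²`), `hasSatakeParamAt_iff_L2` (the two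
notions of Satake parameter agree). Then `hasEntireContinuation_artinLFunction_of_isPiOfArtinRep`
holds: `π = π(σ)` almost everywhere forces `L(s, σ)` to be entire (Tunnell 1981, p. 173 ¶2). Proof:
`hasEntireContinuation_artinLFunction_of_isPiOfArtinRep_of_godementJacquet_of_isAssociatedL2` with
(N) proved (`CuspidalAutomorphicRepData.exists_centerInvariant_hasSatakeParamAt_shift_eventually`).
[cite: Tunnell1981, p. 173] [cite: GodementJacquet1972, Thm. 13.8]
[cite: BorelJacquetCorvallis1979, §4.6 and 5.7] [cite: NeukirchANT1999, VII §12, Thm. (12.6)] -/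
theorem hasEntireContinuation_artinLFunction_of_isPiOfArtinRep_of_four_facts
    (hFE : ∀ (F : Type) [Field F] [NumberField F], artin_functional_equation (K := F))
    (hGJ : ∀ (F : Type) [Field F] [NumberField F]
      (μ : Measure (AdelicGroupData.gl 2 F).automorphicQuotient)
      [(AdelicGroupData.gl 2 F).IsAutomorphicMeasure μ], godementJacquet (n := 2) (K := F) (μ := μ))
    (hA : ∀ (F : Type) [Field F] [NumberField F] (hcpt : isCompact_glFiniteIntegralLevel 2 F)
      (μ : Measure (AdelicGroupData.gl 2 F).automorphicQuotient)
      [(AdelicGroupData.gl 2 F).IsAutomorphicMeasure μ], AutomorphicRepsGL.exists_isAssociatedL2 hcpt μ)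
    (hL2 : ∀ (F : Type) [Field F] [NumberField F] (hcpt : isCompact_glFiniteIntegralLevel 2 F)
      (μ : Measure (AdelicGroupData.gl 2 F).automorphicQuotient)
      [(AdelicGroupData.gl 2 F).IsAutomorphicMeasure μ], hasSatakeParamAt_iff_L2 hcpt μ) :
    hasEntireContinuation_artinLFunction_of_isPiOfArtinRep :=
  hasEntireContinuation_artinLFunction_of_isPiOfArtinRep_of_godementJacquet_of_isAssociatedL2
    hFE hGJ hA hL2 @fun _ _ _ _ π =>
      CuspidalAutomorphicRepData.exists_centerInvariant_hasSatakeParamAt_shift_eventually π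

/-- **The target over `ℚ` from the three cases of strong Artin and the four named facts**
(`langlands_tunnell_hasEntireContinuation_of_cases` with
`hasEntireContinuation_artinLFunction_of_isPiOfArtinRep_of_four_facts`).
[cite: Tunnell1981, p. 173 and Theorem] [cite: LanglandsBaseChange1980, §3] -/
theorem langlands_tunnell_hasEntireContinuation_of_cases_of_four_facts
    (hd : strongArtin_of_isDihedralType) (ht : strongArtin_of_isTetrahedralType)
    (ho : strongArtin_of_isOctahedralType)
    (hFE : ∀ (F : Type) [Field F] [NumberField F], artin_functional_equation (K := F))
    (hGJ : ∀ (F : Type) [Field F] [NumberField F]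
      (μ : Measure (AdelicGroupData.gl 2 F).automorphicQuotient)
      [(AdelicGroupData.gl 2 F).IsAutomorphicMeasure μ], godementJacquet (n := 2) (K := F) (μ := μ))
    (hA : ∀ (F : Type) [Field F] [NumberField F] (hcpt : isCompact_glFiniteIntegralLevel 2 F)
      (μ : Measure (AdelicGroupData.gl 2 F).automorphicQuotient)
      [(AdelicGroupData.gl 2 F).IsAutomorphicMeasure μ], AutomorphicRepsGL.exists_isAssociatedL2 hcpt μ)
    (hL2 : ∀ (F : Type) [Field F] [NumberField F] (hcpt : isCompact_glFiniteIntegralLevel 2 F)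
      (μ : Measure (AdelicGroupData.gl 2 F).automorphicQuotient)
      [(AdelicGroupData.gl 2 F).IsAutomorphicMeasure μ], hasSatakeParamAt_iff_L2 hcpt μ) :
    langlands_tunnell_hasEntireContinuation :=
  langlands_tunnell_hasEntireContinuation_of_cases hd ht ho
    (hasEntireContinuation_artinLFunction_of_isPiOfArtinRep_of_four_facts hFE hGJ hA hL2)

end Main

end Literature.NumberTheory.Automorphic

end
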